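import Summits.HodgeConjecture.HodgeConjecture.Theorems.GenericDivisibilityGenericDivisibilityBoundedSupportedTop
import Literature.AlgebraicGeometry.HodgeTheory.WeilClassesSurfacesProofs
import Literature.AlgebraicGeometry.HodgeTheory.LefschetzOneOneHolds
import Literature.AlgebraicGeometry.HodgeTheory.RationalLatticeIntegral
import Literature.AlgebraicGeometry.HodgeTheory.IntegralClassesCountable
import Literature.AlgebraicGeometry.Motives.AbelianVarietyProjectiveChart

/-!
# `GenericDivisibilityBounded` (C2, stmt-HodgeConjecture-18467) · Negative · the conclusion is tight

Standing disprover, cdisprove gen-2 (refuter-cdisprove-stmt-HodgeConjecture-18467-g2-0, 2026-08-17).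

The conclusion of C2 is "`z ⊗ ℂ ∈ N¹H^{2p}(X(ℂ); ℂ)`" (coniveau `≥ 1`), NOT "`z ⊗ ℂ = 0`" (torsion):
`genericDivisibilityBounded_false_with_conclusionEqZero` — the natural strengthening of C2 replacing
the conclusion by `z ⊗ ℂ = 0` is FALSE. Witness: an abelian surface `B` (the tree's companion Weil
surface `E_i × E_i`, `exists_weilType_abelianSurfaces_holds`, PROVED) with a non-zero RATIONAL class
`b` of type `(1,1)`; by Lefschetz `(1,1)` (`lefschetzOneOne_rational_holds`, PROVED) `b` is a divisor
class, i.e. `b ∈ N¹H²(B(ℂ); ℂ)` (`algebraicClasses B.X 1` IS `supportedClasses B.X 2 1`); an integral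
multiple `N • b = z ⊗ 1` is then generically torsion (`GT = N¹ ∩ H_ℤ`, the lead's
`genericDivisibilityBounded_exists_nsmul_restrict_eq_zero_of_ringChange_mem_supportedClasses`:
`N' • z|_{(X∖Z)(ℂ)} = 0` on a non-empty Zariski open), so `z' = N' • z` restricts to `0` there and is
divisible by EVERY `m` on that open (`y = 0`), while `z' ⊗ 1 = N'N • b ≠ 0`.
So any proof of C2 must produce divisor-supported classes, not vanishing ones: the hypothesis of C2
does hold non-trivially (for every divisor class), and the phantom question is exactly the quotient
`E = H^{2p}(X;ℤ)/GT`, not `H^{2p}(X;ℤ)`. Sorry-free, definition-free; no named fact assumed.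

References: [VoisinHodgeI2002] Thm. 11.30 (Lefschetz (1,1)), §7.1.1; [Schoen1998HodgeWeilAddendum] §10;
[BlochOgus1974ENS] (3.8); [Dimca1992] Ch. 1 Cor. (6.10); [HatcherAT2002] §3.1.
-/

noncomputable section

-- The mandated namespace `Summit.<P>.<Sub>.Theorems.…` repeats `HodgeConjecture` (single-conjunct summit).
set_option linter.dupNamespace false

open CategoryTheory AlgebraicGeometry

namespace Summit.HodgeConjecture.HodgeConjecture.Theorems.GenericDivisibilityBounded.Negative.ConclusionTight

open Literature.AlgebraicGeometry.Motives Literature.AlgebraicGeometry.HodgeTheory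
  Literature.AlgebraicTopology.SingularHomology
open Summit.HodgeConjecture.HodgeConjecture.Theorems

/-- **An integral class that dies on a non-empty Zariski open yet has non-zero complexification**
(on some smooth projective surface: a multiple of a divisor class of `E_i × E_i`). [cite: VoisinHodgeI2002, Thm. 11.30]
[cite: BlochOgus1974ENS, (3.8)] -/
theorem exists_restrict_eq_zero_ringChange_ne_zero :
    ∃ (X : SchemeOver ℂ) (_ : IsSmoothProjective (2 * 1) X)
      (z : singularCohomology ℤ ℤ (ComplexPoints X) (2 * 1)) (Z : Set X.left),
      IsClosed Z ∧ Z ≠ Set.univ ∧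
        singularCohomology.map ℤ ℤ
          (⟨Subtype.val, continuous_subtype_val⟩ : C(complexPointsCompl X Z, ComplexPoints X)) (2 * 1) z = 0 ∧
        singularCohomology.ringChange (Int.castRingHom ℂ) (ComplexPoints X) (2 * 1) z ≠ 0 := by
  obtain ⟨B, -, b, hdim, -, hb0, hbrat, hb11, -⟩ := exists_weilType_abelianSurfaces_holds 1 one_pos
  have hX : IsSmoothProjective (2 * 1) B.X := by
    have h := (AbelianVariety.isSmoothProjective_holds (A := B))
    rw [AbelianVariety.isSmoothProjective, hdim] at h
    exact h
  -- Lefschetz (1,1): `b` is a divisor class, i.e. of coniveau `≥ 1`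
  have hbN : b ∈ supportedClasses B.X (2 * 1) 1 := lefschetzOneOne_rational_holds hX b hbrat hb11
  -- an integral multiple `N • b = z ⊗ 1`
  obtain ⟨N, hN, hNb⟩ := IsRationalClass.exists_nsmul_isIntegralClass hX hbrat
  obtain ⟨z, hz⟩ := (isIntegralClass_iff_mem_range_ringChange _).1 hNb
  have hzN : singularCohomology.ringChange (Int.castRingHom ℂ) (ComplexPoints B.X) (2 * 1) z ∈
      supportedClasses B.X (2 * 1) 1 := by
    rw [hz]; exact Submodule.smul_mem _ _ hbN
  -- `GT = N¹ ∩ H_ℤ`: `N' • z` dies on a non-empty Zariski open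
  obtain ⟨Z, hZc, hZne, N', hN', hres⟩ :=
    genericDivisibilityBounded_exists_nsmul_restrict_eq_zero_of_ringChange_mem_supportedClasses
      hX (k := 2 * 1) (by norm_num) hzN
  refine ⟨B.X, hX, N' • z, Z, hZc, hZne, by rw [map_nsmul, hres], ?_⟩
  rw [map_nsmul, hz, ← Nat.cast_smul_eq_nsmul ℂ, smul_smul]
  have hc : ((N' : ℂ) * N) ≠ 0 :=
    mul_ne_zero (Nat.cast_ne_zero.2 (by omega)) (Nat.cast_ne_zero.2 hN.ne')
  exact smul_ne_zero hc hb0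

/-- **The conclusion of C2 is tight — `N¹`, not `0`**: the strengthening of
`GenericDivisibility.GenericDivisibilityBounded` with conclusion "`z ⊗ ℂ = 0`" is FALSE. The witness
class dies on a fixed non-empty Zariski open (`y = 0` divides it by every `m`) and has non-zero
complexification. [cite: VoisinHodgeI2002, Thm. 11.30] [cite: BlochOgus1974ENS, (3.8)] -/
theorem genericDivisibilityBounded_false_with_conclusionEqZero :
    ¬ (∀ ⦃p : ℕ⦄ ⦃X : SchemeOver ℂ⦄, 1 ≤ p → IsSmoothProjective (2 * p) X →
        ∀ z : singularCohomology ℤ ℤ (ComplexPoints X) (2 * p),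
          (∀ m : ℕ, 1 ≤ m → ∃ Z : Set X.left, IsClosed Z ∧ Z ≠ Set.univ ∧
            ∃ y : singularCohomology ℤ ℤ (complexPointsCompl X Z) (2 * p),
              m • y = singularCohomology.map ℤ ℤ
                (⟨Subtype.val, continuous_subtype_val⟩ : C(complexPointsCompl X Z, ComplexPoints X))
                (2 * p) z) →
          singularCohomology.ringChange (Int.castRingHom ℂ) (ComplexPoints X) (2 * p) z = 0) := by
  intro h
  obtain ⟨X, hX, z, Z, hZc, hZne, hres, hne⟩ := exists_restrict_eq_zero_ringChange_ne_zero
  exact hne (h le_rfl hX z fun m _ ↦ ⟨Z, hZc, hZne, 0, by rw [smul_zero, hres]⟩)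

/-- … while the witness DOES satisfy C2's actual conclusion (it is of coniveau `≥ 1`), so it is a
tightness witness, not a counterexample: the hypothesis of C2 is satisfied non-vacuously by every
divisor-type class, and the content of C2 is the quotient `E = H^{2p}(X;ℤ)/GT`. [cite: BlochOgus1974ENS, (3.8)] -/
theorem exists_hypothesis_holds_ringChange_ne_zero :
    ∃ (X : SchemeOver ℂ) (_ : IsSmoothProjective (2 * 1) X)
      (z : singularCohomology ℤ ℤ (ComplexPoints X) (2 * 1)),
      (∀ m : ℕ, 1 ≤ m → ∃ Z : Set X.left, IsClosed Z ∧ Z ≠ Set.univ ∧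
        ∃ y : singularCohomology ℤ ℤ (complexPointsCompl X Z) (2 * 1),
          m • y = singularCohomology.map ℤ ℤ
            (⟨Subtype.val, continuous_subtype_val⟩ : C(complexPointsCompl X Z, ComplexPoints X)) (2 * 1) z) ∧
      singularCohomology.ringChange (Int.castRingHom ℂ) (ComplexPoints X) (2 * 1) z ≠ 0 ∧
      singularCohomology.ringChange (Int.castRingHom ℂ) (ComplexPoints X) (2 * 1) z ∈
        supportedClasses X (2 * 1) 1 := by
  obtain ⟨X, hX, z, Z, hZc, hZne, hres, hne⟩ := exists_restrict_eq_zero_ringChange_ne_zero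
  refine ⟨X, hX, z, fun m _ ↦ ⟨Z, hZc, hZne, 0, by rw [smul_zero, hres]⟩, hne, ?_⟩
  exact genericDivisibilityBounded_ringChange_mem_supportedClasses hX ⟨Z, hZc, hZne, 1, le_rfl,
    by rw [one_smul, hres]⟩

end Summit.HodgeConjecture.HodgeConjecture.Theorems.GenericDivisibilityBounded.Negative.ConclusionTight

end
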